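/-
Origin: expansion seat `planner-pub-hodgecm-pv05-g7-0`, handover #7 2026-08-18T14:50:22Z (`HOME/pub-hodgecm-pv05-g7/lean/Pv05g7/FockCompactDiagonal.lean`, md5 d9879a7a, 304 lines);
landed by the gen-8 packager in gate run 31 as `HodgeCM/PerL34/FockCompactDiagonal.lean` (import ^import Pv05g7\.FockInfinitesimalLie[ \t]*$→import HodgeCM.PerL34.FockInfinitesimalLie ×1; import ^import Pv05g7\.FockAnalyticVectors[ \t]*$→import HodgeCM.PerL34.FockAnalyticVectors ×1).
-/
/-
Origin: expansion seat `planner-pub-hodgecm-pv05-g7-0` (unit pub-hodgecm-pv05-g7, DAG-NODE PROVER #05 gen 7), leaf #7.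
Handover imports: `Pv05g7.FockInfinitesimalLie` ↦ `HodgeCM.PerL34.FockInfinitesimalLie` (pv05-g7 #3) and
`Pv05g7.FockAnalyticVectors` ↦ `HodgeCM.PerL34.FockAnalyticVectors` (pv05-g7 #5); the tree import
`HodgeCM.PerL34.FockPrintGenuineTorus` (pv12-g7, RUN 29) and `Mathlib.Analysis.Matrix.Spectrum` stay.

# Every compact direction is a torus direction: simultaneous diagonalisation of `ν₀(e^{tX})` and `dΓ(X)`

KERNEL, additive leaf of the pv05 Fock lane (namespace `HodgeCM.PerL34.Fock.Hermite`).  Mathlib + lane only (the one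
tree lemma used from the pv12 lane is `PrintDict.linSubst_diagonal_monomial`); no citation is used as a hypothesis;
hypotheses are `[Fintype σ] [DecidableEq σ]` and the displayed `star X = -X`.

For `X ∈ 𝔲(σ)` (`Xᴴ = −X`) the matrix `iX` is Hermitian, so Mathlib's spectral theorem
(`Matrix.IsHermitian.spectral_theorem`) gives a unitary `V = specU hX ∈ U(σ)` and real FREQUENCIES
`λ = specFreq hX : σ → ℝ` with `X = V · diag(−iλ) · Vᴴ` (`eq_specU_conj`).  Consequences, all in the GENUINE model
`ν₀ = fockRep` on `𝓕_σ ⊂ L²`: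

1. (§2) `e^{tX} = V e^{t·diag(−iλ)} Vᴴ` in `U(σ)` (`expUnitary_eq_conj`) and `e^{t·diag(−iλ)} = diag(e^{−itλ_k})`
   (`exp_smul_diagI`).
2. (§3) a diagonal one-parameter group with ARBITRARY REAL frequencies `μ` acts on the monomial vectors by
   `ν₀(e^{t·diag(−iμ)})(c z^m·e^{−…}) = e^{it⟨m,μ⟩} · c z^m·e^{−…}`, `⟨m,μ⟩ = Σ_k m_k μ_k` (`fockRep_expUnitary_diagI_monomial`)
   — the real-frequency version of the pv12 lane's integer tori `torusU`.
3. (§4) **weight decomposition for an arbitrary compact direction**: the vectors `w_m := ν₀(V)(c z^m·e^{−…})` satisfy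
   `ν₀(e^{tX}) w_m = e^{it⟨m,λ⟩} w_m` for ALL `t` (`fockRep_expUnitary_specVec`), and `{ν₀(V)(ζ_m e^{−…})}_m` is a
   HILBERT BASIS of `𝓕_σ` (`specBasis`, `fockRep_expUnitary_specBasis`): every `ν₀(e^{tX})`, `X ∈ 𝔲(σ)`, is
   diagonal in one orthonormal basis of honest `L²` vectors, with spectrum `{e^{it⟨m,λ⟩}}`.
4. (§5) the same vectors are eigenvectors of the infinitesimal generator: `dΓ(X)(c z^m ∘ Vᴴ) = i⟨m,λ⟩ · (c z^m ∘ Vᴴ)`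
   (`dGamma_specPoly`), via the `Ad`-equivariance `linSubst_dGamma` (#4) and `dΓ(diag d) = −Σ d_j z_j∂_j` (#3); so on
   each `𝓟_d` the skew-Hermitian `dΓ(X)` has spectrum `{i⟨m,λ⟩ : |m| = d}`.

HONEST LABEL.  Compact directions `X ∈ 𝔲(σ)` only (nothing on the non-compact/metaplectic part); `specU`, `specFreq`
are Mathlib's (noncanonical) choice of eigenvector unitary / eigenvalue enumeration for `iX`; no multiplicity or
Weyl-group statement is made.
-/
import Mathlib.Analysis.Matrix.Spectrum
import Summits.HodgeConjecture.HodgeCM.PerL34.FockInfinitesimalLie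
import Summits.HodgeConjecture.HodgeCM.PerL34.FockAnalyticVectors
import Summits.HodgeConjecture.HodgeCM.PerL34.FockPrintGenuineTorus

noncomputable section

namespace HodgeCM.PerL34.Fock.Hermite

open Complex MvPolynomial Matrix NormedSpace
open scoped Real Nat ComplexConjugate InnerProductSpace

/- All inner products below are the Hilbert-space ones of `FockL2 σ` (see the note in `FockLadderAdjoint`). -/
attribute [local instance 10000] InnerProductSpace.toInner

variable {σ : Type*} [Fintype σ] [DecidableEq σ]

/-! ## §1  Matrix level: `X ∈ 𝔲(σ)` is `U(σ)`-conjugate to `diag(−iλ)` with `λ` real -/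

/-- The diagonal skew-Hermitian matrix with real frequencies `μ`: `diagI μ = diag(−iμ_k)`. -/
def diagI (μ : σ → ℝ) : Matrix σ σ ℂ := diagonal fun k => -(I * (μ k : ℂ))

omit [Fintype σ] in
/-- (Ported verbatim from the HodgeCMPerL package; no docstring in the source.) -/
theorem diagI_apply (μ : σ → ℝ) : diagI μ = diagonal fun k => -(I * (μ k : ℂ)) := rfl

omit [Fintype σ] in
/-- (Ported verbatim from the HodgeCMPerL package; no docstring in the source.) -/
theorem star_diagI (μ : σ → ℝ) : star (diagI μ) = -diagI μ := by
  rw [diagI, star_eq_conjTranspose, diagonal_conjTranspose, diagonal_neg, diagonal_eq_diagonal_iff]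
  intro k
  simp only [Pi.star_apply, star_neg, star_mul', Complex.star_def, conj_I, conj_ofReal]
  ring

omit [Fintype σ] [DecidableEq σ] in
/-- (Ported verbatim from the HodgeCMPerL package; no docstring in the source.) -/
theorem isHermitian_I_smul {X : Matrix σ σ ℂ} (hX : star X = -X) : (I • X).IsHermitian := by
  change (I • X)ᴴ = I • X
  rw [conjTranspose_smul, ← star_eq_conjTranspose, hX, Complex.star_def, conj_I, neg_smul_neg]

/-- The diagonalising unitary of `X ∈ 𝔲(σ)` (Mathlib's eigenvector unitary of the Hermitian matrix `iX`). -/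
def specU {X : Matrix σ σ ℂ} (hX : star X = -X) : Matrix.unitaryGroup σ ℂ :=
  (isHermitian_I_smul hX).eigenvectorUnitary

/-- The real frequencies `λ` of `X ∈ 𝔲(σ)` (the eigenvalues of the Hermitian matrix `iX`). -/
def specFreq {X : Matrix σ σ ℂ} (hX : star X = -X) : σ → ℝ :=
  (isHermitian_I_smul hX).eigenvalues

/-- **`X = V · diag(−iλ) · Vᴴ`** with `V = specU hX ∈ U(σ)`, `λ = specFreq hX` real. -/
theorem eq_specU_conj {X : Matrix σ σ ℂ} (hX : star X = -X) :
    X = (specU hX : Matrix σ σ ℂ) * diagI (specFreq hX) * star (specU hX : Matrix σ σ ℂ) := by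
  have h : I • X = (specU hX : Matrix σ σ ℂ) * diagonal (RCLike.ofReal ∘ (isHermitian_I_smul hX).eigenvalues)
      * star (specU hX : Matrix σ σ ℂ) := by
    have h' := (isHermitian_I_smul hX).spectral_theorem
    rwa [Unitary.conjStarAlgAut_apply] at h'
  have hX' : X = (-I) • (I • X) := by rw [smul_smul, neg_mul, I_mul_I, neg_neg, one_smul]
  have hD : diagI (specFreq hX) = (-I) • diagonal (RCLike.ofReal ∘ (isHermitian_I_smul hX).eigenvalues) := by
    rw [diagI, ← diagonal_smul]
    congr 1
    funext k
    simp only [Pi.smul_apply, Function.comp_apply, smul_eq_mul, neg_mul, specFreq]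
    rfl
  rw [hD, Matrix.mul_smul, Matrix.smul_mul, ← h, ← hX']

/-- `Vᴴ X = diag(−iλ) Vᴴ`. -/
theorem star_specU_mul {X : Matrix σ σ ℂ} (hX : star X = -X) :
    star (specU hX : Matrix σ σ ℂ) * X = diagI (specFreq hX) * star (specU hX : Matrix σ σ ℂ) := by
  calc star (specU hX : Matrix σ σ ℂ) * X
        = star (specU hX : Matrix σ σ ℂ)
            * ((specU hX : Matrix σ σ ℂ) * diagI (specFreq hX) * star (specU hX : Matrix σ σ ℂ)) := by
          rw [← eq_specU_conj hX]
    _ = diagI (specFreq hX) * star (specU hX : Matrix σ σ ℂ) := by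
          rw [← Matrix.mul_assoc, ← Matrix.mul_assoc, Unitary.coe_star_mul_self, Matrix.one_mul]

/-! ## §2  `e^{tX} = V · e^{t·diag(−iλ)} · Vᴴ` and `e^{t·diag(−iμ)} = diag(e^{−itμ_k})` -/

omit [DecidableEq σ] in
/-- (Ported verbatim from the HodgeCMPerL package; no docstring in the source.) -/
private theorem cexp_eq_exp (z : ℂ) : NormedSpace.exp z = cexp z :=
  (congr_fun Complex.exp_eq_exp_ℂ z).symm

/-- (Ported verbatim from the HodgeCMPerL package; no docstring in the source.) -/
theorem exp_smul_diagI (μ : σ → ℝ) (u : ℂ) :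
    exp (u • diagI μ) = diagonal fun k => cexp (-(I * u * (μ k : ℂ))) := by
  rw [diagI, ← diagonal_smul, Matrix.exp_diagonal, Pi.exp_def]
  congr 1
  funext k
  rw [Pi.smul_apply, smul_eq_mul, cexp_eq_exp]
  congr 1
  ring

/-- (Ported verbatim from the HodgeCMPerL package; no docstring in the source.) -/
theorem coe_expUnitary_diagI (μ : σ → ℝ) (t : ℝ) :
    (expUnitary (diagI μ) (star_diagI μ) t : Matrix σ σ ℂ) = diagonal fun k => cexp (-(I * t * (μ k : ℂ))) := by
  rw [coe_expUnitary, exp_smul_diagI]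

/-- (Ported verbatim from the HodgeCMPerL package; no docstring in the source.) -/
theorem star_coe_expUnitary_diagI (μ : σ → ℝ) (t : ℝ) :
    star (expUnitary (diagI μ) (star_diagI μ) t : Matrix σ σ ℂ) = diagonal fun k => cexp (I * t * (μ k : ℂ)) := by
  rw [star_coe_expUnitary, ← neg_smul, exp_smul_diagI]
  congr 1
  funext k
  congr 1
  ring

/-- **`e^{tX} = V e^{t·diag(−iλ)} Vᴴ`** at the matrix level. -/
theorem coe_expUnitary_eq_conj {X : Matrix σ σ ℂ} (hX : star X = -X) (t : ℝ) :
    (expUnitary X hX t : Matrix σ σ ℂ)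
      = (specU hX : Matrix σ σ ℂ) * exp ((t : ℂ) • diagI (specFreq hX)) * star (specU hX : Matrix σ σ ℂ) := by
  have hV : IsUnit (specU hX : Matrix σ σ ℂ) := ⟨Unitary.toUnits (specU hX), rfl⟩
  have hinv : (specU hX : Matrix σ σ ℂ)⁻¹ = star (specU hX : Matrix σ σ ℂ) :=
    Matrix.inv_eq_left_inv (Unitary.coe_star_mul_self _)
  rw [coe_expUnitary]
  conv_lhs => rw [eq_specU_conj hX, ← Matrix.smul_mul, ← Matrix.mul_smul, ← hinv]
  rw [Matrix.exp_conj _ _ hV, hinv]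

/-- **`e^{tX} = V · e^{t·diag(−iλ)} · V⁻¹` in the group `U(σ)`.** -/
theorem expUnitary_eq_conj {X : Matrix σ σ ℂ} (hX : star X = -X) (t : ℝ) :
    expUnitary X hX t
      = specU hX * expUnitary (diagI (specFreq hX)) (star_diagI _) t * (specU hX)⁻¹ :=
  Subtype.ext (by
    rw [Matrix.UnitaryGroup.mul_val, Matrix.UnitaryGroup.mul_val, Matrix.UnitaryGroup.inv_val, coe_expUnitary_eq_conj]
    rfl)

/-! ## §3  Diagonal one-parameter groups with real frequencies act on monomial vectors by phases -/

/-- `⟨m, μ⟩ = Σ_k m_k μ_k`, the weight of the monomial `z^m` against the frequencies `μ`. -/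
def wtPair (m : σ →₀ ℕ) (μ : σ → ℝ) : ℝ := ∑ k, (m k : ℝ) * μ k

omit [DecidableEq σ] in
/-- (Ported verbatim from the HodgeCMPerL package; no docstring in the source.) -/
theorem wtPair_apply (m : σ →₀ ℕ) (μ : σ → ℝ) : wtPair m μ = ∑ k, (m k : ℝ) * μ k := rfl

omit [DecidableEq σ] in
/-- (Ported verbatim from the HodgeCMPerL package; no docstring in the source.) -/
theorem prod_cexp_pow (m : σ →₀ ℕ) (a : σ → ℂ) :
    ∏ k, cexp (a k) ^ m k = cexp (∑ k, (m k : ℂ) * a k) := by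
  rw [Complex.exp_sum]
  exact Finset.prod_congr rfl fun k _ => by rw [← Complex.exp_nat_mul]

/-- The substitution `Vᴴ`-side of a diagonal group element multiplies `c z^m` by `e^{it⟨m,μ⟩}`. -/
theorem linSubst_star_expUnitary_diagI_monomial (μ : σ → ℝ) (t : ℝ) (m : σ →₀ ℕ) (c : ℂ) :
    linSubst (star (expUnitary (diagI μ) (star_diagI μ) t : Matrix σ σ ℂ)) (monomial m c)
      = cexp (I * t * (wtPair m μ : ℂ)) • monomial m c := by
  rw [star_coe_expUnitary_diagI, PrintDict.linSubst_diagonal_monomial, prod_cexp_pow, MvPolynomial.C_mul']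
  congr 2
  rw [wtPair, Complex.ofReal_sum, Finset.mul_sum]
  exact Finset.sum_congr rfl fun k _ => by push_cast; ring

/-- **Real-frequency torus on monomial vectors.**  `ν₀(e^{t·diag(−iμ)})(c z^m·e^{−(π/2)|z|²}) = e^{it⟨m,μ⟩}·(c z^m·e^{−…})`. -/
theorem fockRep_expUnitary_diagI_monomial (μ : σ → ℝ) (t : ℝ) (m : σ →₀ ℕ) (c : ℂ) :
    fockRep (expUnitary (diagI μ) (star_diagI μ) t) (fockToL2 (monomial m c))
      = cexp (I * t * (wtPair m μ : ℂ)) • fockToL2 (monomial m c) := by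
  rw [fockRep_fockToL2, linSubst_star_expUnitary_diagI_monomial, map_smul]

/-- In particular on the orthonormal Hermite basis `ζ_m·e^{−…} = fockBasis m`. -/
theorem fockRep_expUnitary_diagI_fockBasis (μ : σ → ℝ) (t : ℝ) (m : σ →₀ ℕ) :
    fockRep (expUnitary (diagI μ) (star_diagI μ) t) (fockBasis m)
      = cexp (I * t * (wtPair m μ : ℂ)) • fockBasis m := by
  rw [fockBasis_apply, ← fockToL2_zeta, zeta, map_smul, LinearIsometryEquiv.map_smul,
    fockRep_expUnitary_diagI_monomial, smul_comm]

/-! ## §4  Weight decomposition of `ν₀(e^{tX})` for an arbitrary `X ∈ 𝔲(σ)` -/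

/-- `ν₀(V e V⁻¹)(ν₀(V) w) = ν₀(V)(ν₀(e) w)`. -/
theorem fockRep_conj_apply (V E : Matrix.unitaryGroup σ ℂ) (w : FockL2 σ) :
    fockRep (V * E * V⁻¹) (fockRep V w) = fockRep V (fockRep E w) := by
  rw [map_mul, map_mul, map_inv, LinearIsometryEquiv.coe_mul, LinearIsometryEquiv.coe_mul, Function.comp_apply,
    Function.comp_apply, LinearIsometryEquiv.coe_inv, LinearIsometryEquiv.symm_apply_apply]

/-- **Eigenvectors of every `ν₀(e^{tX})`.**  For `X ∈ 𝔲(σ)` with `X = V diag(−iλ) Vᴴ`: the honest `L²` vectors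
`w = ν₀(V)(c z^m·e^{−(π/2)|z|²})` satisfy `ν₀(e^{tX}) w = e^{it⟨m,λ⟩} w` for every `t ∈ ℝ`. -/
theorem fockRep_expUnitary_specVec {X : Matrix σ σ ℂ} (hX : star X = -X) (t : ℝ) (m : σ →₀ ℕ) (c : ℂ) :
    fockRep (expUnitary X hX t) (fockRep (specU hX) (fockToL2 (monomial m c)))
      = cexp (I * t * (wtPair m (specFreq hX) : ℂ)) • fockRep (specU hX) (fockToL2 (monomial m c)) := by
  rw [expUnitary_eq_conj hX t, fockRep_conj_apply, fockRep_expUnitary_diagI_monomial, LinearIsometryEquiv.map_smul]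

/-- The same on the transported Hermite basis `ν₀(V)(ζ_m·e^{−…})`. -/
theorem fockRep_expUnitary_specU_fockBasis {X : Matrix σ σ ℂ} (hX : star X = -X) (t : ℝ) (m : σ →₀ ℕ) :
    fockRep (expUnitary X hX t) (fockRep (specU hX) (fockBasis m))
      = cexp (I * t * (wtPair m (specFreq hX) : ℂ)) • fockRep (specU hX) (fockBasis m) := by
  rw [expUnitary_eq_conj hX t, fockRep_conj_apply, fockRep_expUnitary_diagI_fockBasis, LinearIsometryEquiv.map_smul]

/-- A unitary image of the Hermite Hilbert basis is again a Hilbert basis (orthonormal with trivial orthogonal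
complement). -/
theorem orthonormal_fockRep_fockBasis (U : Matrix.unitaryGroup σ ℂ) :
    Orthonormal ℂ (fun m : σ →₀ ℕ => fockRep U (fockBasis m)) :=
  (fockBasis (σ := σ)).orthonormal.comp_linearIsometryEquiv (fockRep U)

/-- (Ported verbatim from the HodgeCMPerL package; no docstring in the source.) -/
theorem span_fockRep_fockBasis_orthogonal_eq_bot (U : Matrix.unitaryGroup σ ℂ) :
    (Submodule.span ℂ (Set.range fun m : σ →₀ ℕ => fockRep U (fockBasis m)))ᗮ = ⊥ := by
  rw [Submodule.eq_bot_iff]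
  intro x hx
  have h0 : ∀ m, ⟪(fockBasis m : FockL2 σ), (fockRep U).symm x⟫_ℂ = 0 := fun m => by
    rw [← (fockRep U).inner_map_map, LinearIsometryEquiv.apply_symm_apply]
    exact Submodule.inner_right_of_mem_orthogonal (Submodule.subset_span (Set.mem_range_self m)) hx
  have hrepr : (fockBasis (σ := σ)).repr ((fockRep U).symm x) = 0 :=
    lp.ext (funext fun m => by rw [HilbertBasis.repr_apply_apply]; exact h0 m)
  have hy : (fockRep U).symm x = 0 := by simpa using hrepr
  simpa using congrArg (fockRep U) hy

/-- **The spectral Hilbert basis of `X ∈ 𝔲(σ)`**: `specBasis hX m = ν₀(V)(ζ_m·e^{−(π/2)|z|²})`, an orthonormal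
basis of the genuine Fock space `𝓕_σ ⊂ L²(ℂ^σ)` consisting of honest functions. -/
def specBasis {X : Matrix σ σ ℂ} (hX : star X = -X) : HilbertBasis (σ →₀ ℕ) ℂ (FockL2 σ) :=
  HilbertBasis.mkOfOrthogonalEqBot (orthonormal_fockRep_fockBasis (specU hX))
    (span_fockRep_fockBasis_orthogonal_eq_bot (specU hX))

/-- (Ported verbatim from the HodgeCMPerL package; no docstring in the source.) -/
theorem specBasis_apply {X : Matrix σ σ ℂ} (hX : star X = -X) (m : σ →₀ ℕ) :
    specBasis hX m = fockRep (specU hX) (fockBasis m) := by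
  rw [specBasis, HilbertBasis.coe_mkOfOrthogonalEqBot]

/-- **Simultaneous diagonalisation.**  Every member of the one-parameter group `ν₀(e^{tX})`, `X ∈ 𝔲(σ)`, is DIAGONAL
in the Hilbert basis `specBasis hX` of `𝓕_σ`, with eigenvalues `e^{it⟨m,λ⟩}`, `λ = specFreq hX`. -/
theorem fockRep_expUnitary_specBasis {X : Matrix σ σ ℂ} (hX : star X = -X) (t : ℝ) (m : σ →₀ ℕ) :
    fockRep (expUnitary X hX t) (specBasis hX m) = cexp (I * t * (wtPair m (specFreq hX) : ℂ)) • specBasis hX m := by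
  rw [specBasis_apply, fockRep_expUnitary_specU_fockBasis]

/-- Coordinates: `ν₀(e^{tX})` multiplies the `m`-th coefficient in `specBasis hX` by `e^{it⟨m,λ⟩}`. -/
theorem specBasis_repr_fockRep_expUnitary {X : Matrix σ σ ℂ} (hX : star X = -X) (t : ℝ) (v : FockL2 σ)
    (m : σ →₀ ℕ) :
    (specBasis hX).repr (fockRep (expUnitary X hX t) v) m
      = cexp (I * t * (wtPair m (specFreq hX) : ℂ)) * (specBasis hX).repr v m := by
  rw [HilbertBasis.repr_apply_apply, HilbertBasis.repr_apply_apply]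
  -- `⟪b_m, ν(e_t) v⟫ = ⟪ν(e_t) ν(e_{-t}) b_m, ν(e_t) v⟫ = ⟪e^{-it⟨m,λ⟩} b_m, v⟫ = e^{it⟨m,λ⟩} ⟪b_m, v⟫`
  have h : specBasis hX m = fockRep (expUnitary X hX t) (fockRep (expUnitary X hX (-t)) (specBasis hX m)) := by
    rw [expUnitary_neg, map_inv, LinearIsometryEquiv.coe_inv, LinearIsometryEquiv.apply_symm_apply]
  conv_lhs => rw [h, LinearIsometryEquiv.inner_map_map, fockRep_expUnitary_specBasis]
  rw [inner_smul_left (E := FockL2 σ), ← Complex.exp_conj]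
  congr 2
  simp only [map_mul, map_neg, Complex.conj_I, Complex.conj_ofReal, Complex.ofReal_neg]
  ring

/-! ## §5  The infinitesimal side: the same vectors diagonalise `dΓ(X)` -/

omit [Fintype σ] [DecidableEq σ] in
/-- Euler on monomials: `z_j ∂_j (c z^m) = m_j · c z^m`. -/
theorem X_mul_pderiv_self_monomial (j : σ) (m : σ →₀ ℕ) (c : ℂ) :
    X j * pderiv j (monomial m c) = ((m j : ℕ) : ℂ) • monomial m c := by
  rw [pderiv_monomial]
  by_cases hj : m j = 0
  · simp [hj]
  · rw [X, monomial_mul, one_mul, add_tsub_cancel_of_le (Finsupp.single_le_iff.mpr (Nat.one_le_iff_ne_zero.mpr hj)),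
      smul_monomial, smul_eq_mul, mul_comm]

/-- `dΓ(diag d)(c z^m) = −(Σ_j m_j d_j) · c z^m`. -/
theorem dGamma_diagonal_monomial (d : σ → ℂ) (m : σ →₀ ℕ) (c : ℂ) :
    dGamma (diagonal d) (monomial m c) = (-∑ j, (m j : ℂ) * d j) • monomial m c := by
  rw [dGamma_diagonal, LinearMap.neg_apply, LinearMap.sum_apply, neg_smul, Finset.sum_smul]
  congr 1
  exact Finset.sum_congr rfl fun j _ => by
    rw [LinearMap.smul_apply, mulXPDeriv_apply, X_mul_pderiv_self_monomial, smul_smul, mul_comm]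

/-- `dΓ(diag(−iμ))(c z^m) = i⟨m,μ⟩ · c z^m`. -/
theorem dGamma_diagI_monomial (μ : σ → ℝ) (m : σ →₀ ℕ) (c : ℂ) :
    dGamma (diagI μ) (monomial m c) = (I * (wtPair m μ : ℂ)) • monomial m c := by
  rw [diagI, dGamma_diagonal_monomial]
  congr 1
  rw [wtPair, Complex.ofReal_sum, Finset.mul_sum, ← Finset.sum_neg_distrib]
  exact Finset.sum_congr rfl fun j _ => by push_cast; ring

/-- **Eigenvectors of `dΓ(X)`.**  For `X ∈ 𝔲(σ)`, `X = V diag(−iλ) Vᴴ`: the polynomials `c z^m ∘ Vᴴ` (whose Fock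
vectors are the `ν₀(V)(c z^m·e^{−…})` of §4, `fockRep_fockToL2`) satisfy `dΓ(X)(c z^m ∘ Vᴴ) = i⟨m,λ⟩·(c z^m ∘ Vᴴ)`. -/
theorem dGamma_specPoly {X : Matrix σ σ ℂ} (hX : star X = -X) (m : σ →₀ ℕ) (c : ℂ) :
    dGamma X (linSubst (star (specU hX : Matrix σ σ ℂ)) (monomial m c))
      = (I * (wtPair m (specFreq hX) : ℂ)) • linSubst (star (specU hX : Matrix σ σ ℂ)) (monomial m c) := by
  rw [← linSubst_dGamma (star_specU_mul hX), dGamma_diagI_monomial, map_smul]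

/-- The §4 eigenvectors written through the core: `ν₀(V)(c z^m·e^{−…}) = (c z^m ∘ Vᴴ)·e^{−…}`, so §4 and §5
diagonalise `ν₀(e^{tX})` and `dΓ(X)` in the SAME vectors, with eigenvalues `e^{it⟨m,λ⟩}` and `i⟨m,λ⟩`. -/
theorem fockRep_specU_fockToL2 {X : Matrix σ σ ℂ} (hX : star X = -X) (F : MvPolynomial σ ℂ) :
    fockRep (specU hX) (fockToL2 F) = fockToL2 (linSubst (star (specU hX : Matrix σ σ ℂ)) F) :=
  fockRep_fockToL2 _ F

/-- (Ported verbatim from the HodgeCMPerL package; no docstring in the source.) -/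
theorem fockToL2_dGamma_specPoly {X : Matrix σ σ ℂ} (hX : star X = -X) (m : σ →₀ ℕ) (c : ℂ) :
    fockToL2 (dGamma X (linSubst (star (specU hX : Matrix σ σ ℂ)) (monomial m c)))
      = (I * (wtPair m (specFreq hX) : ℂ)) • fockRep (specU hX) (fockToL2 (monomial m c)) := by
  rw [dGamma_specPoly, map_smul, fockRep_specU_fockToL2]

end HodgeCM.PerL34.Fock.Hermite
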